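import Mathlib
import HarnessLib
import Literature.Analysis.FluidPDE.VectorCalculus
import Summits.NavierStokesRegularity.NavierStokesRegularity.Theorems.UnthreadedRigidityDoorUnthreadedRigidityVirialHornAngularJets
import Summits.NavierStokesRegularity.NavierStokesRegularity.Theorems.UnthreadedRigidityDoorUnthreadedRigidityVirialHornAngularLemma

/-!
# Route `UnthreadedRigidityDoor`, wall item W2 `UnthreadedRigidity` (stmt-NavierStokesRegularity-27585) — LINE g12-2 «PERSISTENCE FILTER»
# (ns-idea-6 g12, `Persistence_sketch.lean` 09bc8f71301208c4; DIRECTOR-NS #294): support S–M «AFFINE GRADIENT LAW» `GradSqAffineLaw` —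
# part (A): an affine gradient law `|∇Y|² = aY + c` on `S²` kills the angular form, hence `Y` is ZONAL (S-C `angularLemma_holds`)

Seat ns-es-p1 g8 (W2 second queue; announce-before-propose on the ideators bus).  Typed sub-split of `GradSqAffineLaw` (T1 of 3).

* `normSq_gradient_eq_of_affine` — homogeneity transports the sphere law to `ℝ³ ∖ {0}`: `|∇Y(z)|² = a|z|^{l−2}Y(z) + c|z|^{2l−2}`.
* `angForm_eq_zero_of_affine` — `{Y,|∇Y|²} ≡ 0`: at `y` with `w = y × ∇Y(y) ≠ 0` differentiate `t ↦ |∇Y(γ(t))|²` along the circle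
  `γ(t) = cos t·y + sin t·(|y|/|w|)w` of radius `|y|` (on which `|∇Y|² = a|y|^{l−2}Y + const`): the derivative at `0` is `(|y|/|w|)⟪∇|∇Y|², w⟫`
  on the one hand and `a|y|^{l−2}(|y|/|w|)⟪∇Y, w⟫ = 0` on the other; and `{Y,|∇Y|²}(y) = ⟪w, ∇|∇Y|²(y)⟫` (`IsSolidHarmonic.angForm_eq`).
* `isZonal_of_affine` — hence `Y` is zonal, by the tree's S-C `angularLemma_holds`.

HONEST LABEL: calculus about special separable data (support of a files-only rung line); nothing here bears on `UnthreadedRigidity` (27585), the door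
Target, W2 or Navier–Stokes regularity; no summit statement is proved.  MODEL/rung work.
-/

noncomputable section

-- the summit and its single sub-problem share the name (CONVENTIONS §1), as in every Theorems file
set_option linter.dupNamespace false

namespace Summit.NavierStokesRegularity.NavierStokesRegularity.Theorems.UnthreadedRigidity.Persistence

open scoped InnerProductSpace Topology
open Set Filter
open Literature.Analysis.FluidPDE (cross crossCLM)
open Summit.NavierStokesRegularity.NavierStokesRegularity.Theorems.UnthreadedRigidity.ProfileHorn (E3)
open Summit.NavierStokesRegularity.NavierStokesRegularity.Theorems.UnthreadedRigidity.VirialHorn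
  (IsSolidHarmonic angForm IsZonal angularLemma_holds)

variable {l : ℕ} {Y : E3 → ℝ}

/-! ## Two coordinate facts about the cross product -/

/-- `⟪a, a × b⟫ = 0`. -/
theorem inner_self_cross (a b : E3) : ⟪a, cross a b⟫_ℝ = 0 := by
  simp [cross, cross_apply, PiLp.inner_apply, Fin.sum_univ_three]; ring

/-- `⟪b, a × b⟫ = 0`. -/
theorem inner_cross_self (a b : E3) : ⟪b, cross a b⟫_ℝ = 0 := by
  simp [cross, cross_apply, PiLp.inner_apply, Fin.sum_univ_three]; ring

/-! ## The sphere law transported by homogeneity -/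

/-- `|∇Y(z)|² = a|z|^{l−2} Y(z) + c|z|^{2l−2}` off the origin, for a solid harmonic of degree `l = m + 2` with the affine law on `S²`. -/
theorem normSq_gradient_eq_of_affine {m : ℕ} (hY : IsSolidHarmonic (m + 2) Y) {a c : ℝ}
    (haff : ∀ y : E3, ‖y‖ = 1 → ‖gradient Y y‖ ^ 2 = a * Y y + c) {z : E3} (hz : z ≠ 0) :
    ‖gradient Y z‖ ^ 2 = a * ‖z‖ ^ m * Y z + c * ‖z‖ ^ (2 * m + 2) := by
  have hρ : 0 < ‖z‖ := norm_pos_iff.2 hz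
  have hu : ‖(‖z‖⁻¹ : ℝ) • z‖ = 1 := by
    rw [norm_smul, norm_inv, norm_norm, inv_mul_cancel₀ hρ.ne']
  have h := haff _ hu
  have hg : gradient Y ((‖z‖⁻¹ : ℝ) • z) = (‖z‖⁻¹) ^ (m + 1) • gradient Y z := by
    rw [hY.gradient_smul _ (inv_pos.2 hρ)]
    congr 1
    rw [show ((m + 2 : ℕ) : ℤ) - 1 = ((m + 1 : ℕ) : ℤ) by push_cast; ring, zpow_natCast]
  rw [hg, hY.apply_smul, norm_smul, mul_pow, norm_pow, norm_inv, norm_norm] at h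
  -- `h : ((‖z‖⁻¹)^(m+1))² · G = a · ((‖z‖⁻¹)^(m+2) · Y) + c`; clear denominators
  have hρ' : ‖z‖ ≠ 0 := hρ.ne'
  have e1 : (‖z‖⁻¹ ^ (m + 1)) ^ 2 = (‖z‖ ^ (2 * m + 2))⁻¹ := by
    rw [← pow_mul, inv_pow]; ring_nf
  have e2 : ‖z‖⁻¹ ^ (m + 2) = (‖z‖ ^ (m + 2))⁻¹ := inv_pow _ _
  rw [e1, e2] at h
  calc ‖gradient Y z‖ ^ 2 = ‖z‖ ^ (2 * m + 2) * ((‖z‖ ^ (2 * m + 2))⁻¹ * ‖gradient Y z‖ ^ 2) := by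
        field_simp
    _ = ‖z‖ ^ (2 * m + 2) * (a * ((‖z‖ ^ (m + 2))⁻¹ * Y z) + c) := by rw [h]
    _ = a * ‖z‖ ^ m * Y z + c * ‖z‖ ^ (2 * m + 2) := by
        field_simp
        ring

/-! ## The angular form vanishes -/

/-- **An affine gradient law on `S²` kills the angular form `{Y,|∇Y|²}`** (module docstring). -/
theorem angForm_eq_zero_of_affine {m : ℕ} (hY : IsSolidHarmonic (m + 2) Y) {a c : ℝ}
    (haff : ∀ y : E3, ‖y‖ = 1 → ‖gradient Y y‖ ^ 2 = a * Y y + c) (y : E3) : angForm Y y = 0 := by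
  rw [hY.angForm_eq]
  set g : E3 := gradient Y y with hg
  set w : E3 := cross y g with hw
  set S : E3 →L[ℝ] E3 := fderiv ℝ (gradient Y) y with hS
  by_cases hw0 : w = 0
  · rw [hw0, inner_zero_left, mul_zero]
  have hy0 : y ≠ 0 := by
    rintro rfl
    apply hw0
    rw [hw]
    ext i
    fin_cases i <;> simp [cross]
  have hρ : 0 < ‖y‖ := norm_pos_iff.2 hy0
  have hwn : 0 < ‖w‖ := norm_pos_iff.2 hw0
  -- the circle of radius `|y|` through `y` with initial velocity `v ∥ w`
  set v : E3 := (‖y‖ / ‖w‖) • w with hv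
  have hyv : ⟪y, v⟫_ℝ = 0 := by rw [hv, inner_smul_right, hw, inner_self_cross, mul_zero]
  have hgv : ⟪g, v⟫_ℝ = 0 := by rw [hv, inner_smul_right, hw, inner_cross_self, mul_zero]
  have hvn : ‖v‖ = ‖y‖ := by
    rw [hv, norm_smul, Real.norm_of_nonneg (by positivity), div_mul_cancel₀ _ hwn.ne']
  set γ : ℝ → E3 := fun t => Real.cos t • y + Real.sin t • v with hγ
  have hγn : ∀ t, ‖γ t‖ = ‖y‖ := by
    intro t
    have h1 : ‖γ t‖ ^ 2 = ‖y‖ ^ 2 := by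
      rw [hγ]
      simp only
      rw [norm_add_sq_real, norm_smul, norm_smul, inner_smul_left, inner_smul_right, hyv, hvn,
        Real.norm_eq_abs, Real.norm_eq_abs, mul_pow, mul_pow, sq_abs, sq_abs]
      nlinarith [Real.cos_sq_add_sin_sq t]
    have h2 : 0 ≤ ‖γ t‖ := norm_nonneg _
    nlinarith [h1, h2, hρ]
  have hγ0 : γ 0 = y := by simp [hγ]
  have hγd : HasDerivAt γ v 0 := by
    have h1 : HasDerivAt (fun t => Real.cos t • y) (-(Real.sin 0) • y) 0 := (Real.hasDerivAt_cos 0).smul_const y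
    have h2 : HasDerivAt (fun t => Real.sin t • v) (Real.cos 0 • v) 0 := (Real.hasDerivAt_sin 0).smul_const v
    have h := h1.add h2
    simp only [Real.sin_zero, neg_zero, zero_smul, Real.cos_zero, one_smul, zero_add] at h
    exact h
  -- first computation of `(|∇Y|² ∘ γ)′(0)`
  have hG : HasDerivAt (fun t => ‖gradient Y (γ t)‖ ^ 2) (2 * ⟪S g, v⟫_ℝ) 0 := by
    have h1 := hY.hasGradientAt_normSq y
    rw [hasGradientAt_iff_hasFDerivAt] at h1
    rw [← hγ0] at h1
    have h2 := h1.comp_hasDerivAt 0 hγd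
    rw [hγ0] at h2
    simpa [InnerProductSpace.toDual_apply_apply, Function.comp_def, real_inner_smul_left] using h2
  -- second computation, through the transported sphere law on the circle
  have hfun : (fun t => ‖gradient Y (γ t)‖ ^ 2) = fun t => a * ‖y‖ ^ m * Y (γ t) + c * ‖y‖ ^ (2 * m + 2) := by
    funext t
    have hγt : γ t ≠ 0 := by
      intro h0; have := hγn t; rw [h0, norm_zero] at this; exact hρ.ne' this.symm
    rw [normSq_gradient_eq_of_affine hY haff hγt, hγn t]
  have hYd : HasDerivAt (fun t => Y (γ t)) (⟪g, v⟫_ℝ) 0 := by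
    have h1 : HasGradientAt Y g y := ((hY.contDiff.differentiable (by simp)) y).hasGradientAt
    rw [hasGradientAt_iff_hasFDerivAt, ← hγ0] at h1
    have h2 := h1.comp_hasDerivAt 0 hγd
    simpa [InnerProductSpace.toDual_apply_apply, Function.comp_def] using h2
  have hG' : HasDerivAt (fun t => ‖gradient Y (γ t)‖ ^ 2) (a * ‖y‖ ^ m * ⟪g, v⟫_ℝ) 0 := by
    rw [hfun]
    simpa using (hYd.const_mul (a * ‖y‖ ^ m)).add_const (c * ‖y‖ ^ (2 * m + 2))
  -- compare
  have heq : 2 * ⟪S g, v⟫_ℝ = a * ‖y‖ ^ m * ⟪g, v⟫_ℝ := hG.unique hG'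
  rw [hgv, mul_zero, hv, real_inner_smul_right] at heq
  have h3 : ⟪S g, w⟫_ℝ = 0 := by
    have h4 : ‖y‖ / ‖w‖ ≠ 0 := (div_pos hρ hwn).ne'
    have h5 : ‖y‖ / ‖w‖ * ⟪S g, w⟫_ℝ = 0 := by linarith
    exact (mul_eq_zero.1 h5).resolve_left h4
  rw [real_inner_comm, h3, mul_zero]

/-- **An affine gradient law on `S²` makes a solid harmonic of degree `l ≥ 2` ZONAL** (S-C `angularLemma_holds`). -/
theorem isZonal_of_affine (hl : 2 ≤ l) (hY : IsSolidHarmonic l Y) {a c : ℝ}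
    (haff : ∀ y : E3, ‖y‖ = 1 → ‖gradient Y y‖ ^ 2 = a * Y y + c) : IsZonal Y := by
  obtain ⟨m, rfl⟩ : ∃ m, l = m + 2 := ⟨l - 2, by omega⟩
  exact angularLemma_holds (m + 2) Y hY (angForm_eq_zero_of_affine hY haff)

end Summit.NavierStokesRegularity.NavierStokesRegularity.Theorems.UnthreadedRigidity.Persistence

end
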